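import Summits.MatrixMultiplication.MatrixMultiplication.Theorems.AbelianSTPPCensusU11KPSharp

/-!
# Rule U11-KP♯: the printed conjecture implies the hypothesis; comparison with U11-KP; the separating example `(7,7,7)⁵ @ 648`

Cell mm-stpp (rung F-M1), theory lane gen 15 (census-silent; companion of `AbelianSTPPCensusU11KPSharp`, split off for the 400-line rule).
* `kneserPollardSharp_of_printed` — Grynkiewicz–Wang 2026 Conjecture 2.2 AS PRINTED (predicate `KneserPollard.KneserPollardConclusion` of
  `AbelianSTPPCensusU11KP`, for all data) implies the sharp Kneser–Pollard hypothesis of `u11KPSharpSound_of_kneserPollardSharp`;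
* `lossKPSharp_le_lossKP`, `u11KPFormB_of_sharp`, `u11KP_of_sharp`, `not_u11KPSharp_of_not_u11KP` — U11-KP♯ refines U11-KP clause-wise (so the six
  kills of `AbelianSTPPCensusU11KPWalls` are U11-KP♯ kills);
* `w648_u11KP`, `w648_not_u11KPSharp` — the uniform list `(7,7,7)⁵` at `648 = 2³·3⁴` (beats `τ = 5/2` by `0.21`, quartet-alive by the seat twin
  `calc/u11c.py` / theory g14's `quartet.py`) passes U11-KP at every `t` (all `b_i = 7`: the periods `u ≤ 7` are never excluded and the crude
  loss `7(t − 14)` covers the deficit) but fails U11-KP♯ (`t = 44`: the divisors of `648` dividing some `44 − u`, `u ≤ 7`, are `≤ 8`; loss `13`).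
WHAT THIS IS NOT: conditional throughout (the hypothesis is an OPEN conjecture, explicit in every statement); no census number; no `ω`.
-/

set_option linter.dupNamespace false -- `MatrixMultiplication.MatrixMultiplication` (summit = problem, D-0017)
set_option autoImplicit false

namespace Summit.MatrixMultiplication.MatrixMultiplication.Theorems

open Finset Literature.Computability.AlgebraicComplexity Literature.Combinatorics.Additive
open scoped Pointwise

variable {N : ℕ}

/-- **The printed conjecture implies the sharp hypothesis** (so every `…_of_kneserPollardSharp` theorem applies under GW26 Conjecture 2.2 as
printed). [original] -/
theorem kneserPollardSharp_of_printed
    (hC : ∀ (G : Type) [AddCommGroup G] [DecidableEq G] (A B : Finset G) (t : ℕ),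
      1 ≤ t → t ≤ A.card → t ≤ B.card →
      (∑ x ∈ A + B, min t (Pollard.rep A B x)) + t * t < t * A.card + t * B.card →
      KneserPollard.KneserPollardConclusion A B t) :
    ∀ (G : Type) [AddCommGroup G] [DecidableEq G] (A B : Finset G) (t : ℕ),
      1 ≤ t → t ≤ A.card → t ≤ B.card → KneserPollard.KneserPollardDichotomySharp A B t := by
  intro G _ _ A B t ht hA hB
  apply KneserPollard.kneserPollardDichotomySharp_of_conclusion
  by_cases hlt : (∑ x ∈ A + B, min t (Pollard.rep A B x)) + t * t < t * A.card + t * B.card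
  · exact Or.inr (hC G A B t ht hA hB hlt)
  · exact Or.inl (by omega)

/-- U11-KP♯ refines U11-KP clause-wise: `lossKPSharp M t ≤ lossKP t` (every pair `(u, h)` of the sharp loss has `2u ≤ u + h ≤ t` and
`u(h − u) − slack ≤ u(t − 2u)`), so a U11-KP♯-admissible list is U11-KP-admissible. [bookkeeping] -/
theorem lossKPSharp_le_lossKP (M : ℕ) (a b c : Fin N → ℕ) (t : ℕ) : lossKPSharp M a b c t ≤ lossKP a b c t := by
  unfold lossKPSharp
  refine Finset.sup_le fun p hp => ?_
  rw [mem_filter, mem_product, mem_range] at hp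
  obtain ⟨⟨hpt, -⟩, h1, h2, -, h4, h5⟩ := hp
  have hmem : p.1 ∈ (range t).filter fun u => 1 ≤ u ∧ 2 * u ≤ t ∧ lB a b c u < u := by
    rw [mem_filter, mem_range]; exact ⟨by omega, h1, by omega, h5⟩
  calc p.1 * (p.2 - p.1) - hullSlack (pCAlt a b c t) p.2 ≤ p.1 * (p.2 - p.1) := Nat.sub_le _ _
    _ ≤ p.1 * (t - 2 * p.1) := Nat.mul_le_mul_left _ (by omega)
    _ ≤ lossKP a b c t := le_sup (f := fun u => u * (t - 2 * u)) hmem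

/-- U11-KP♯ implies U11-KP (form B). [bookkeeping] -/
theorem u11KPFormB_of_sharp {M : ℕ} {a b c : Fin N → ℕ} (h : U11KPSharpFormB M a b c) : U11KPFormB M a b c :=
  fun t ht1 htX htY htL => (h t ht1 htX htY htL).trans (Nat.add_le_add_left (lossKPSharp_le_lossKP M a b c t) _)

/-- U11-KP♯ implies U11-KP (three forms). [bookkeeping] -/
theorem u11KP_of_sharp {M : ℕ} {a b c : Fin N → ℕ} (h : U11KPSharp M a b c) : U11KP M a b c :=
  ⟨u11KPFormB_of_sharp h.1, u11KPFormB_of_sharp h.2.1, u11KPFormB_of_sharp h.2.2⟩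

/-- A U11-KP kill is a U11-KP♯ kill. [bookkeeping] -/
theorem not_u11KPSharp_of_not_u11KP {M : ℕ} {a b c : Fin N → ℕ} (h : ¬ U11KP M a b c) : ¬ U11KPSharp M a b c :=
  fun hs => h (u11KP_of_sharp hs)

/-! ### The two rules differ: the uniform list `(7,7,7)⁵` at `648 = 2³·3⁴` (beats `τ = 5/2` by `0.21`; quartet-alive by the seat twin) -/

/-- `(7,7,7)⁵` passes U11-KP at order `648`: every `b_i = 7`, so the periods `u ≤ 7` are never excluded by the fibre lemma and the crude loss
`7(t − 14)` covers the Pollard deficit at every `t`. [original] -/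
theorem w648_u11KP : U11KP 648 (![7, 7, 7, 7, 7] : Fin 5 → ℕ) ![7, 7, 7, 7, 7] ![7, 7, 7, 7, 7] := by
  refine ⟨?_, ?_, ?_⟩ <;> (unfold U11KPFormB; decide +kernel)

/-- `(7,7,7)⁵` fails U11-KP♯ at order `648` (form B, `t = 44`: the divisors `h` of `648` with `h ∣ 44 − u` for some `u ≤ min(7, h)` are
`1, 2, 3, 4, 6, 8`, and the best pair `(u, h) = (4, 8)` loses only `16 − hullSlack(245, 8) = 13`; floor `44·490 − 44² − 13 = 19 611 >`
ceiling `1 715 + 44·403 = 19 447`). [original] -/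
theorem w648_not_u11KPSharp : ¬ U11KPSharp 648 (![7, 7, 7, 7, 7] : Fin 5 → ℕ) ![7, 7, 7, 7, 7] ![7, 7, 7, 7, 7] := by
  rintro ⟨h, -, -⟩
  have := h 44 (by norm_num) (by decide) (by decide) (by decide)
  revert this
  decide +kernel

end Summit.MatrixMultiplication.MatrixMultiplication.Theorems
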